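import Literature.Geometry.Lorentzian.KerrNullRadialPotential
import HarnessLib

/-!
# The photon shell is sharp: spherical photon orbits at every radius between the photon radii

(family `gr`; namespace `Literature.Geometry.Lorentzian.Kerr`; companion to
`KerrPhotonShellTurningPoints.lean`.)

`KerrPhotonShellTurningPoints.lean` proves that every Θ-admissible root `c` of the null radial
Carter potential `R` has `R′(c) > 0` for `c > r_ph⁻ = photonOrbitRadius M |a|` and `R′(c) < 0` for
`r₊ < c < r_ph⁺ = photonOrbitRadius M (−|a|)`. Here the complementary fact: **for every
`c ∈ [r_ph⁺, r_ph⁻]` there are non-trivial Θ-admissible null constants with `R(c) = R′(c) = 0`**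
(`exists_doubleRoot_of_mem_photonShell`) — the constants of Teo's SPHERICAL PHOTON ORBIT of radius
`c` (`sphericalImpact`, `sphericalCarter`: `λ = −(c³ − 3Mc² + a²c + a²M)/(a(c − M))`,
`η = −c³(c³ − 6Mc² + 9M²c − 4a²M)/(a²(c − M)²)`, E. Teo, Gen. Rel. Grav. 35 (2003), eqs. (8)–(9);
for `a = 0` the photon sphere `c = 3M`, `η + λ² = 27M²`). So the dichotomy of the turning-point
file fails exactly on the closed shell, and (through `Hess r = R′/(2Σ²)` of
`KerrRadiusPseudoconvexity.lean`) no cylinder `{r = c}` with `c` in the shell is strongly null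
pseudo-convex from either side — the stopping radii of the Ionescu–Klainerman sweeps are sharp
(Sbierski's trapping obstruction, geometrically).

Ingredients: the photon-orbit cubic `p(c) = c(c − 3M)² − 4Ma²` is `≤ 0` on the shell
(`photonCubic_nonpos_of_mem_photonShell`: every shell radius is `photonOrbitRadius M x` for some
`|x| ≤ |a|` by continuity, and `p = 4M(x² − a²)` there), which is exactly `η ≥ 0`.

## References

* E. Teo, *Spherical photon orbits around a Kerr black hole*, Gen. Relativity Gravitation 35
  (2003) 1909–1926, eqs. (8)–(9).
* J. M. Bardeen, W. H. Press, S. A. Teukolsky, Astrophys. J. 178 (1972) 347, §II.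
-/

noncomputable section

open Set Real

namespace Literature.Geometry.Lorentzian

namespace Kerr

/-! ### Every shell radius is a `photonOrbitRadius` -/

/-- `x ↦ photonOrbitRadius M x = 4M cos²(⅓ arccos(x/M))` is continuous. [folklore] -/
theorem continuous_photonOrbitRadius (M : ℝ) : Continuous fun x : ℝ ↦ photonOrbitRadius M x := by
  unfold photonOrbitRadius photonOrbitSqrtRadius photonOrbitAngle
  fun_prop

/-- **Every radius of the closed photon shell `[r_ph⁺, r_ph⁻]` is the radius of an equatorial-type
closed form `photonOrbitRadius M x` with `|x| ≤ |a|`** (intermediate value theorem along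
`x ∈ [−|a|, |a|]`). [cite: BardeenPressTeukolsky1972, §II] -/
theorem exists_photonOrbitRadius_eq_of_mem_photonShell {M a c : ℝ}
    (h₁ : photonOrbitRadius M (-|a|) ≤ c) (h₂ : c ≤ photonOrbitRadius M |a|) :
    ∃ x : ℝ, |x| ≤ |a| ∧ photonOrbitRadius M x = c := by
  have hab : -|a| ≤ |a| := by linarith [abs_nonneg a]
  have hmem : c ∈ Icc (photonOrbitRadius M (-|a|)) (photonOrbitRadius M |a|) := ⟨h₁, h₂⟩
  obtain ⟨x, hx, hxc⟩ :=
    intermediate_value_Icc hab (continuous_photonOrbitRadius M).continuousOn hmem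
  exact ⟨x, abs_le.2 ⟨hx.1, hx.2⟩, hxc⟩

/-- **The photon-orbit cubic is non-positive on the shell**: `c(c − 3M)² − 4Ma² ≤ 0` for
`r_ph⁺ ≤ c ≤ r_ph⁻` (`0 < M`, `|a| ≤ M`): at `c = photonOrbitRadius M x` it equals `4M(x² − a²)`.
[cite: BardeenPressTeukolsky1972, §II] -/
theorem photonCubic_nonpos_of_mem_photonShell {M a c : ℝ} (hM : 0 < M) (ha : |a| ≤ M)
    (h₁ : photonOrbitRadius M (-|a|) ≤ c) (h₂ : c ≤ photonOrbitRadius M |a|) :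
    c * (c - 3 * M) ^ 2 - 4 * M * a ^ 2 ≤ 0 := by
  obtain ⟨x, hx, rfl⟩ := exists_photonOrbitRadius_eq_of_mem_photonShell h₁ h₂
  have hp := photonOrbit_p_eq_zero_of_abs_le hM (hx.trans ha)
  have hx2 : x ^ 2 ≤ a ^ 2 := by
    rw [← sq_abs x, ← sq_abs a]
    exact pow_le_pow_left₀ (abs_nonneg x) hx 2
  nlinarith

/-! ### The spherical photon orbit constants -/

/-- The **impact parameter `λ = L/E` of the spherical photon orbit of radius `c`** (`a ≠ 0`,
`c ≠ M`): `λ = −(c³ − 3Mc² + a²c + a²M)/(a(c − M))`. Teo 2003, eq. (8). [cite: Teo2003, eq. (8)] -/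
def sphericalImpact (M a c : ℝ) : ℝ :=
  -(c ^ 3 - 3 * M * c ^ 2 + a ^ 2 * c + a ^ 2 * M) / (a * (c - M))

/-- The **Carter parameter `η = Q/E²` of the spherical photon orbit of radius `c`**:
`η = −c³(c³ − 6Mc² + 9M²c − 4a²M)/(a²(c − M)²)`. Teo 2003, eq. (9). [cite: Teo2003, eq. (9)] -/
def sphericalCarter (M a c : ℝ) : ℝ :=
  -(c ^ 3 * (c ^ 3 - 6 * M * c ^ 2 + 9 * M ^ 2 * c - 4 * a ^ 2 * M)) / (a ^ 2 * (c - M) ^ 2)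

/-- **`R(c) = 0` for the spherical orbit constants** `(E, L, Q) = (1, λ(c), η(c))`
(`a ≠ 0`, `c ≠ M`). Teo 2003, §2. [cite: Teo2003, §2] -/
theorem nullRadialPotential_spherical {M a c : ℝ} (ha : a ≠ 0) (hc : c ≠ M) :
    nullRadialPotential M a 1 (sphericalImpact M a c) (sphericalCarter M a c) c = 0 := by
  have hcM : c - M ≠ 0 := sub_ne_zero.2 hc
  unfold nullRadialPotential sphericalImpact sphericalCarter
  field_simp
  ring

/-- **`R′(c) = 0` for the spherical orbit constants** (`a ≠ 0`, `c ≠ M`): the root is double, so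
`r ≡ c` solves Carter's radial equation `Σ² ṙ² = R(r)` with `r̈ = R′/(2Σ²) = 0` — a spherical
photon orbit. Teo 2003, §2. [cite: Teo2003, §2] -/
theorem deriv_nullRadialPotential_spherical {M a c : ℝ} (ha : a ≠ 0) (hc : c ≠ M) :
    deriv (nullRadialPotential M a 1 (sphericalImpact M a c) (sphericalCarter M a c)) c = 0 := by
  have hcM : c - M ≠ 0 := sub_ne_zero.2 hc
  rw [deriv_nullRadialPotential]
  unfold sphericalImpact sphericalCarter
  field_simp
  ring

/-- **`η(c) ≥ 0` exactly where the photon-orbit cubic is `≤ 0`**: for `c > 0`, `c ≠ M`, `a ≠ 0`,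
`c(c − 3M)² − 4Ma² ≤ 0 ⇒ 0 ≤ η(c)` (`c³ − 6Mc² + 9M²c − 4a²M = c(c − 3M)² − 4Ma²`). [folklore] -/
theorem sphericalCarter_nonneg {M a c : ℝ} (ha : a ≠ 0) (hc : c ≠ M) (hc0 : 0 < c)
    (hp : c * (c - 3 * M) ^ 2 - 4 * M * a ^ 2 ≤ 0) : 0 ≤ sphericalCarter M a c := by
  unfold sphericalCarter
  have hden : 0 < a ^ 2 * (c - M) ^ 2 := by
    have h1 : 0 < a ^ 2 := by positivity
    have h2 : 0 < (c - M) ^ 2 := by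
      have : c - M ≠ 0 := sub_ne_zero.2 hc
      positivity
    exact mul_pos h1 h2
  rw [neg_div, neg_nonneg, div_nonpos_iff]
  refine Or.inr ⟨?_, hden.le⟩
  have hq : c ^ 3 - 6 * M * c ^ 2 + 9 * M ^ 2 * c - 4 * a ^ 2 * M = c * (c - 3 * M) ^ 2 - 4 * M * a ^ 2 := by
    ring
  rw [hq]
  exact mul_nonpos_of_nonneg_of_nonpos (by positivity) hp

/-! ### The dichotomy is sharp on the shell -/

/-- **Spherical photon orbits fill the shell — sharpness of the turning-point dichotomy.** For
`0 < M`, `|a| < M` and every radius `c` of the CLOSED photon shell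
`photonOrbitRadius M (−|a|) ≤ c ≤ photonOrbitRadius M |a|` there are Θ-admissible, non-trivial
null constants `(E, L, Q)` with `R(c) = 0` AND `R′(c) = 0`: for `a ≠ 0` Teo's spherical orbit
constants `(1, λ(c), η(c))` (admissible with witness `z = 0` since `η ≥ 0` on the shell), for
`a = 0` the photon sphere `c = 3M` with `(1, 0, 27M²)`. Hence
`Kerr.deriv_nullRadialPotential_pos_of_photonOrbitRadius_lt` /
`…_neg_of_lt_photonOrbitRadius_neg` cannot be extended to any shell radius, and by
`Hess r = R′/(2Σ²)` (`KerrRadiusPseudoconvexity.lean`) no cylinder `{r = c}`, `c` in the shell, is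
strongly null pseudo-convex from either side. Teo, Gen. Rel. Grav. 35 (2003), eqs. (8)–(9).
[cite: Teo2003, §2] -/
theorem exists_doubleRoot_of_mem_photonShell {M a c : ℝ} (hM : 0 < M) (ha : |a| < M)
    (h₁ : photonOrbitRadius M (-|a|) ≤ c) (h₂ : c ≤ photonOrbitRadius M |a|) :
    ∃ E L Q : ℝ, NullThetaAdmissible a E L Q ∧ (E ≠ 0 ∨ L ≠ 0 ∨ Q ≠ 0) ∧
      nullRadialPotential M a E L Q c = 0 ∧ deriv (nullRadialPotential M a E L Q) c = 0 := by
  by_cases ha0 : a = 0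
  · -- the photon sphere `c = 3M`
    subst ha0
    have h3 : photonOrbitRadius M 0 = 3 * M := by
      have h := photonOrbit_p_eq_zero_of_abs_le hM (x := 0) (by simpa using hM.le)
      have hge : 3 * M ≤ photonOrbitRadius M 0 := (photonOrbitRadius_mem hM le_rfl).1
      have hpos : 0 < photonOrbitRadius M 0 := by linarith
      have : (photonOrbitRadius M 0 - 3 * M) ^ 2 = 0 := by
        have h' : photonOrbitRadius M 0 * (photonOrbitRadius M 0 - 3 * M) ^ 2 = 0 := by
          simpa using h
        rcases mul_eq_zero.1 h' with h0 | h0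
        · exact absurd h0 hpos.ne'
        · exact h0
      nlinarith [sq_nonneg (photonOrbitRadius M 0 - 3 * M)]
    simp only [abs_zero, neg_zero, h3] at h₁ h₂
    have hc : c = 3 * M := le_antisymm h₂ h₁
    subst hc
    refine ⟨1, 0, 27 * M ^ 2, ⟨0, by norm_num, by positivity⟩, Or.inl one_ne_zero, ?_, ?_⟩
    · unfold nullRadialPotential; ring
    · rw [deriv_nullRadialPotential]; ring
  · -- Teo's spherical orbit of radius `c`
    have hMc : M < c := by
      have := (photonOrbitRadius_neg_mem hM (by linarith [abs_nonneg a]) (by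
        linarith [abs_nonneg a] : -|a| ≤ 0)).1
      linarith
    have hc : c ≠ M := hMc.ne'
    have hc0 : 0 < c := hM.trans hMc
    have hp := photonCubic_nonpos_of_mem_photonShell hM ha.le h₁ h₂
    refine ⟨1, sphericalImpact M a c, sphericalCarter M a c, ⟨0, by norm_num, ?_⟩,
      Or.inl one_ne_zero, nullRadialPotential_spherical ha0 hc,
      deriv_nullRadialPotential_spherical ha0 hc⟩
    have hη := sphericalCarter_nonneg (M := M) ha0 hc hc0 hp
    simpa using hη

end Kerr

end Literature.Geometry.Lorentzian

end
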